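import Summits.QuantumFields.BalabanUV.T4Continuum.Support.VariationalCovariantTwoRuns

/-!
# T⁴ programme, spine node NE2 (U1a), lane P2 — SUPPLIER ITEM (O2) «L-NE3», THE TWO-RUNS ADAPTER, file 2 of 2:
# `LocalRate` + size class ⟹ `L^k·‖Π_L R_{k+1} − R_k‖ ≤ 2Cθ^k + (α²∕2)e^α·(L⁻¹)^k` — the NE3 part of the spliced tower's one-block transport
# mismatch (`VariationalCovariantFederbush.mis`) and leaf s8's aligned-connection number `ρ` with `L^k·ρ` geometric, consumed BY NAME

NE2 formalisation swarm `b2b-balaban-t4-ne2-formalise-*`, leaf prover 09 (gen 4), supplier item (O2) of the P2 skeleton `t4/skeletons/NE2-t4-ne2-p2.md`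
§7; file 1 = `VariationalCovariantTwoRuns` (addresses, `towReadings`, `LocalRate` ⇔ child∕parent consistency, the one-level product estimate).  Inputs BY
NAME: file 1, `VariationalCovariantTower.Rtr` (p213109), `VariationalCovariantLipschitz.scalar_lipschitz_abs` (leaf s8, p212809),
`VariationalCovariantFederbush.mis` (p210720), node U1b's `T4EtaRateMin.LocalRate`.
 * §5 THE TOWER COROLLARY: `fineOf R k` (the level-`k+1` member in one-step-fine coordinates; `Rtr_fineOf : Rtr (fineOf R k) = R (k+1)` — the `hRtr`
   identity of `VariationalCovariantTowerLaw.oneStepAveragedLaw_scalarTower_sqrt`), `quotT` ∕ `compT_quotT` ∕ `norm_quotT` (the quotient one-step site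
   transport of the spliced tower and its `hTcomp` identity `compT (T k) (quotT (T k) (T (k+1))) = T (k+1)`), **`lev_mul_norm_coarsen_sub_le`** (size `α` + consistency `β` ⟹
   `L^k·‖coarsen (fineOf R k) − R k‖ ≤ β + (α²∕2)·e^α∕L^k`), **`lev_mul_norm_coarsen_sub_le_of_localRate`** (`… ≤ 2Cθ^k + (α²∕2)e^α·(L⁻¹)^k`) and
   **`…_lev`** (at node U1b's honest rate `0 ≤ θ ≤ L⁻¹`: `≤ (2C + (α²∕2)e^α)·(L⁻¹)^k`), **`…_max`** (any `0 ≤ θ`: rate `max θ L⁻¹`, the owner's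
   CLASS-θ variant) and **`sq_lev_mul_norm_coarsen_sub_le_of_localRate`**
   (`(L^k)²·‖…‖ ≤ 2C + (α²∕2)e^α`, k-UNIFORM — LITERALLY the class-hypothesis currency `n²·m_k ≤ c_m` of the road owner's «P2-END»
   `VariationalCovariantEnd.towerLimitRate_scalarTower_closed` for the NE3 part of the mismatch);
 * §6 PLUG SHAPES: **`lev_mul_norm_mis_le_of_localRate`** (the spliced tower's `hmis` ⟸ NE3 part + run B's OWN part `mis (coarsen R′) R′ T′` — the
   latter is the CLASS geometric leaf (O3), not this file), **`lev_mul_norm_sub_coarse_le_of_localRate`** (the same split for the END's face-crossing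
   defect `hcross`: any dressed crossing phase `X` against `R k y μ`), `rhoNE3` ∕ `lev_mul_rhoNE3`, **`hrho_of_localRate`** (leaf s8's `hρ` for equal site transports)
   and **`two_runs_lipschitz_of_localRate`** = `scalar_lipschitz_abs` with `hρ` DISCHARGED from `LocalRate`:
   `|Δ′(Π_L R_{k+1}, T)(μ) − Δ′(R_k, T)(μ)| ≤ (2δ_k√(ΛC_P(Λ+1)) + δ_k²C_P(Λ+1))·nsq μ`, `δ_k = √d·(L^k·ρ_k)`, `L^k·ρ_k = 2Cθ^k + (α²∕2)e^α(L⁻¹)^k`.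
WHAT IS NOT HERE (stated, not hidden): any discharge of `LocalRate` (node NE3 OPEN, DISPLAYED); any identification of `𝒟` with Bałaban's minimisers
(no B0, c5); run B's own loop defect (O3); the END (owner).  The size hypothesis `‖L^k·(R k − 1)‖ ≤ α` is the small-field complete-axial-gauge SHAPE of
row B5's `RegularTransporters.size` on the P2 carriers — a hypothesis on DATA.

HONEST FRAMING (T4-DAG p. 1).  Model level (U(1) charged-scalar sector of road P2; towers and site transports DATA); bookkeeping + one elementary
product estimate; nothing printed is a hypothesis; no `def … : Prop` fact; no `sorry`; axioms standard.  NE3 OPEN; NE2 NOT proved; spine PROVED 0∕9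
unchanged; rung (B)+1 finite T⁴ — NOT infinite volume, NOT a mass gap, NOT Clay.  HONEST DEPENDENCY (cell, verbatim): continuum YM on T⁴ ⇐ BetaPertH ∧
nine spine estimates (0/9 proved); BetaPertH ⇐ (D1) ∧ (D4) ∧ CAP+tail; G-an2-4 gates asym, D1 and NE2/3/4.
-/

noncomputable section

open scoped BigOperators ComplexConjugate

namespace Summit.QuantumFields.BalabanUV.T4Continuum.VariationalCovariantTwoRunsNE3

open Finset
open Literature.MathematicalPhysics.QuantumFieldTheory.Balaban1983to89
open Literature.MathematicalPhysics.QuantumFieldTheory.Balaban1983to89.B5Prop11Plancherel (Tor fine unitVec)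
open Literature.MathematicalPhysics.QuantumFieldTheory.Balaban1983to89.B5Prop11Lower (nsq)
open Literature.MathematicalPhysics.QuantumFieldTheory.Balaban1983to89.B5Block118 (bpt iota up tstep tstep_zero tstep_succ)
open Literature.MathematicalPhysics.QuantumFieldTheory.Balaban1983to89.B5Blocks16 (bpt_bijective)
open Literature.MathematicalPhysics.QuantumFieldTheory.Balaban1983to89.B5Composition116 (sites)
open Literature.MathematicalPhysics.QuantumFieldTheory.Balaban1983to89.T4EtaRateMin (Readings LocalRate)
open Summit.QuantumFields.BalabanUV.T4Continuum.VariationalTransfer (blockSpin)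
open Summit.QuantumFields.BalabanUV.T4Continuum.VariationalCovariantFederbush (piT mis)
open Summit.QuantumFields.BalabanUV.T4Continuum.VariationalCovariantScalarPair (Sc qW Qk)
open Summit.QuantumFields.BalabanUV.T4Continuum.VariationalCovariantLipschitz (aligned phaseRatio scalar_lipschitz_abs)
open Literature.MathematicalPhysics.QuantumFieldTheory.Balaban1983to89.B5Blocks16 (blockOf)
open Summit.QuantumFields.BalabanUV.T4Continuum.VariationalCovariantTower (Rtr compT)
open Summit.QuantumFields.BalabanUV.T4Continuum.VariationalCovariantTwoRuns

variable {d : ℕ} (L : ℕ) [NeZero L] (M : Fin d → ℕ) [hM : ∀ μ, NeZero (M μ)]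

/-! ## §5 The tower corollary: `L^k·‖Π_L R_{k+1} − R_k‖` from size + consistency, and from `LocalRate` -/

/-- the level-`k+1` member of a tower in one-step-fine coordinates over level `k` (the `R′ k` of the canonical pair). [folklore] -/
def fineOf (R : (k : ℕ) → Tor (fine (L ^ k) M) → Fin d → ℂ) (k : ℕ) : Tor (fine L (fine (L ^ k) M)) → Fin d → ℂ :=
  fun x' μ => R (k + 1) ((sites (L ^ k) L M).symm x') μ

omit [NeZero L] hM in
/-- `fineOf` unfolds. [folklore] -/
theorem fineOf_apply (R : (k : ℕ) → Tor (fine (L ^ k) M) → Fin d → ℂ) (k : ℕ) (x' : Tor (fine L (fine (L ^ k) M))) (μ : Fin d) :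
    fineOf L M R k x' μ = R (k + 1) ((sites (L ^ k) L M).symm x') μ := rfl

omit [NeZero L] hM in
/-- the `hRtr` identity of `VariationalCovariantTowerLaw`: transporting `fineOf R k` back gives `R (k+1)`. [folklore] -/
theorem Rtr_fineOf (R : (k : ℕ) → Tor (fine (L ^ k) M) → Fin d → ℂ) (k : ℕ) : Rtr (L ^ k) L M (fineOf L M R k) = R (k + 1) := by
  funext x μ
  simp [Rtr, fineOf]

/-- the QUOTIENT one-step site transport of two consecutive levels' site transports `T` (level `n`) and `S` (level `n·L`), in one-step-fine
coordinates: `T′(x′) = conj(T(block of x′))·S(x′)` (the `T′ k` of the spliced tower; road owner's remark CLAIMS.log l.10100). [folklore] -/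
def quotT (n : ℕ) [NeZero n] (T : Tor (fine n M) → ℂ) (S : Tor (fine (n * L) M) → ℂ) (x' : Tor (fine L (fine n M))) : ℂ :=
  (starRingEnd ℂ) (T (blockOf L (fine n M) x')) * S ((sites n L M).symm x')

/-- **the `hTcomp` identity of `VariationalCovariantTowerLaw` for the spliced tower**: composing a unit-modulus `T` with the quotient transport
returns `S`: `compT T (quotT T S) = S`. [folklore] -/
theorem compT_quotT (n : ℕ) [NeZero n] {T : Tor (fine n M) → ℂ} (hT : ∀ x, ‖T x‖ = 1) (S : Tor (fine (n * L) M) → ℂ) :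
    compT n L M T (quotT L M n T S) = S := by
  funext x
  simp only [compT, quotT, Equiv.symm_apply_apply]
  rw [← mul_assoc, Complex.mul_conj', hT]
  simp

/-- the quotient transport is unit-modulus. [folklore] -/
theorem norm_quotT (n : ℕ) [NeZero n] {T : Tor (fine n M) → ℂ} (hT : ∀ x, ‖T x‖ = 1) {S : Tor (fine (n * L) M) → ℂ}
    (hS : ∀ x, ‖S x‖ = 1) (x' : Tor (fine L (fine n M))) : ‖quotT L M n T S x'‖ = 1 := by
  rw [quotT, norm_mul, Complex.norm_conj, hT, hS, one_mul]

omit hM in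
/-- **SIZE + CONSISTENCY ⟹ THE STRAIGHT PRODUCT IS THE COARSE PHASE TO SECOND ORDER**: if `‖L^{k+1}·(R (k+1) − 1)‖ ≤ α` everywhere and
`‖L^{k+1}·(R (k+1) (child) − 1) − L^k·(R k (parent) − 1)‖ ≤ β` at every child bond, then for every coarse bond
`L^k·‖coarsen (fineOf R k) (y,μ) − R k y μ‖ ≤ β + (α²∕2)·e^α ∕ L^k`. [folklore] -/
theorem lev_mul_norm_coarsen_sub_le (R : (k : ℕ) → Tor (fine (L ^ k) M) → Fin d → ℂ) (k : ℕ) {α β : ℝ} (hα : 0 ≤ α)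
    (hsize : ∀ x μ, ‖((L ^ (k + 1) : ℕ) : ℂ) * (R (k + 1) x μ - 1)‖ ≤ α)
    (hcons : ∀ (y : Tor (fine (L ^ k) M)) (j : Fin d → Fin L) (μ : Fin d),
      ‖((L ^ (k + 1) : ℕ) : ℂ) * (R (k + 1) ((sites (L ^ k) L M).symm (bpt L (fine (L ^ k) M) y j)) μ - 1)
        - ((L ^ k : ℕ) : ℂ) * (R k y μ - 1)‖ ≤ β)
    (y : Tor (fine (L ^ k) M)) (μ : Fin d) :
    ((L ^ k : ℕ) : ℝ) * ‖coarsen L (fine (L ^ k) M) (fineOf L M R k) y μ - R k y μ‖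
      ≤ β + α ^ 2 / 2 * Real.exp α / (L ^ k : ℕ) := by
  have hL1 : (1 : ℝ) ≤ L := Nat.one_le_cast.mpr (Nat.one_le_iff_ne_zero.mpr (NeZero.ne L))
  have hn1 : (1 : ℝ) ≤ ((L ^ k : ℕ) : ℝ) := by push_cast; exact one_le_pow₀ hL1
  have hn0 : (0 : ℝ) < ((L ^ k : ℕ) : ℝ) := lt_of_lt_of_le one_pos hn1
  have hn'0 : (0 : ℝ) < ((L ^ (k + 1) : ℕ) : ℝ) := by push_cast; positivity
  -- per-bond size in one-step-fine coordinates: `‖R′ − 1‖ ≤ α / L^{k+1}`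
  set b : ℝ := α / ((L ^ (k + 1) : ℕ) : ℝ) with hb
  have hb0 : 0 ≤ b := div_nonneg hα hn'0.le
  have hsize' : ∀ t : ℕ, ‖fineOf L M R k (bpt L (fine (L ^ k) M) y 0 + tstep (fine L (fine (L ^ k) M)) μ t) μ - 1‖ ≤ b := by
    intro t
    rw [fineOf_apply, hb, le_div_iff₀ hn'0, mul_comm, ← Complex.norm_natCast, ← norm_mul]
    exact hsize _ _
  have hcons' : ∀ t < L, ‖((L ^ k * L : ℕ) : ℂ) * (fineOf L M R k (bpt L (fine (L ^ k) M) y 0 + tstep (fine L (fine (L ^ k) M)) μ t) μ - 1)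
      - ((L ^ k : ℕ) : ℂ) * (R k y μ - 1)‖ ≤ β := by
    intro t ht
    rw [fineOf_apply]
    have := hcons y (axisOff L μ ⟨t, ht⟩) μ
    rwa [← bpt_zero_add_tstep] at this
  have key := norm_piT_sub_le L (fine (L ^ k) M) (fineOf L M R k) (bpt L (fine (L ^ k) M) y 0) μ (R k y μ - 1) (L ^ k) hb0 hsize' hcons'
  rw [add_sub_cancel] at key
  -- second order: `L^k·(L·b)²/2·(1+b)^L ≤ (α²/2)·e^α / L^k`
  have hLb : (L : ℝ) * b = α / ((L ^ k : ℕ) : ℝ) := by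
    rw [hb]; push_cast; field_simp; ring
  have hpow : (1 + b) ^ L ≤ Real.exp α := by
    calc (1 + b) ^ L ≤ (Real.exp b) ^ L := by
          gcongr
          rw [add_comm]; exact Real.add_one_le_exp b
      _ = Real.exp (L * b) := by rw [← Real.exp_nat_mul]
      _ ≤ Real.exp α := by
          rw [Real.exp_le_exp, hLb]
          exact div_le_self hα hn1
  calc ((L ^ k : ℕ) : ℝ) * ‖coarsen L (fine (L ^ k) M) (fineOf L M R k) y μ - R k y μ‖
      ≤ β + ((L ^ k : ℕ) : ℝ) * ((L * b) ^ 2 / 2 * (1 + b) ^ L) := key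
    _ ≤ β + ((L ^ k : ℕ) : ℝ) * ((L * b) ^ 2 / 2 * Real.exp α) := by gcongr
    _ = β + α ^ 2 / 2 * Real.exp α / (L ^ k : ℕ) := by
        rw [hLb]; field_simp

omit [NeZero L] in
/-- `1 / L^k = (L⁻¹)^k` as reals. [folklore] -/
theorem inv_lev_eq (k : ℕ) : (((L ^ k : ℕ) : ℝ))⁻¹ = ((L : ℝ)⁻¹) ^ k := by
  push_cast; rw [inv_pow]

/-- **THE TWO-RUNS ADAPTER**: node U1b's `LocalRate (towReadings 𝒟) C θ` and the size class `‖L^k·(R k − 1)‖ ≤ α` give, for every tower of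
the class, every level and every coarse bond, `L^k·‖coarsen (fineOf R k) (y,μ) − R k y μ‖ ≤ 2Cθ^k + (α²∕2)e^α·(L⁻¹)^k`. [folklore] -/
theorem lev_mul_norm_coarsen_sub_le_of_localRate {𝒟 : Set ((k : ℕ) → Tor (fine (L ^ k) M) → Fin d → ℂ)} {C θ α : ℝ}
    (hα : 0 ≤ α) (h : LocalRate (towReadings L M 𝒟) C θ) {R : (k : ℕ) → Tor (fine (L ^ k) M) → Fin d → ℂ} (hR : R ∈ 𝒟)
    (hsize : ∀ k x μ, ‖((L ^ k : ℕ) : ℂ) * (R k x μ - 1)‖ ≤ α) (k : ℕ) (y : Tor (fine (L ^ k) M)) (μ : Fin d) :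
    ((L ^ k : ℕ) : ℝ) * ‖coarsen L (fine (L ^ k) M) (fineOf L M R k) y μ - R k y μ‖
      ≤ 2 * (C * θ ^ k) + α ^ 2 / 2 * Real.exp α * ((L : ℝ)⁻¹) ^ k := by
  have := lev_mul_norm_coarsen_sub_le L M R k hα (hsize (k + 1)) (fun y j μ => consistent_of_localRate L M h hR k y j μ) y μ
  rwa [div_eq_mul_inv, inv_lev_eq] at this

/-- the same at node U1b's honest rate `0 ≤ θ ≤ L⁻¹`, ONE geometric constant: `L^k·‖coarsen (fineOf R k) − R k‖ ≤ (2C + (α²∕2)e^α)·(L⁻¹)^k` —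
the class-hypothesis currency `L^k·m_k ≤ c_m·(L^k)⁻¹` of the road owner's «P2-END» for the NE3 part of the mismatch. [folklore] -/
theorem lev_mul_norm_coarsen_sub_le_of_localRate_lev {𝒟 : Set ((k : ℕ) → Tor (fine (L ^ k) M) → Fin d → ℂ)} {C θ α : ℝ}
    (hC : 0 ≤ C) (hθ : 0 ≤ θ) (hθL : θ ≤ (L : ℝ)⁻¹) (hα : 0 ≤ α) (h : LocalRate (towReadings L M 𝒟) C θ)
    {R : (k : ℕ) → Tor (fine (L ^ k) M) → Fin d → ℂ} (hR : R ∈ 𝒟) (hsize : ∀ k x μ, ‖((L ^ k : ℕ) : ℂ) * (R k x μ - 1)‖ ≤ α)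
    (k : ℕ) (y : Tor (fine (L ^ k) M)) (μ : Fin d) :
    ((L ^ k : ℕ) : ℝ) * ‖coarsen L (fine (L ^ k) M) (fineOf L M R k) y μ - R k y μ‖
      ≤ (2 * C + α ^ 2 / 2 * Real.exp α) * ((L : ℝ)⁻¹) ^ k := by
  refine (lev_mul_norm_coarsen_sub_le_of_localRate L M hα h hR hsize k y μ).trans ?_
  have hθk : θ ^ k ≤ ((L : ℝ)⁻¹) ^ k := pow_le_pow_left₀ hθ hθL k
  nlinarith [mul_le_mul_of_nonneg_left hθk hC, sq_nonneg α, Real.exp_pos α,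
    mul_nonneg (mul_nonneg (div_nonneg (sq_nonneg α) zero_le_two) (Real.exp_pos α).le) (pow_nonneg (inv_nonneg.mpr (Nat.cast_nonneg L)) k)]

/-- the same at ANY honest rate `0 ≤ θ` of node U1b (no comparison with `L⁻¹` assumed): ONE geometric constant at the rate `max θ L⁻¹` —
the road owner's «CLASS-θ» variant `n·m_k ≤ c_m·θ′^k`, `θ′ = max θ L⁻¹`. [folklore] -/
theorem lev_mul_norm_coarsen_sub_le_of_localRate_max {𝒟 : Set ((k : ℕ) → Tor (fine (L ^ k) M) → Fin d → ℂ)} {C θ α : ℝ}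
    (hC : 0 ≤ C) (hθ : 0 ≤ θ) (hα : 0 ≤ α) (h : LocalRate (towReadings L M 𝒟) C θ)
    {R : (k : ℕ) → Tor (fine (L ^ k) M) → Fin d → ℂ} (hR : R ∈ 𝒟) (hsize : ∀ k x μ, ‖((L ^ k : ℕ) : ℂ) * (R k x μ - 1)‖ ≤ α)
    (k : ℕ) (y : Tor (fine (L ^ k) M)) (μ : Fin d) :
    ((L ^ k : ℕ) : ℝ) * ‖coarsen L (fine (L ^ k) M) (fineOf L M R k) y μ - R k y μ‖
      ≤ (2 * C + α ^ 2 / 2 * Real.exp α) * (max θ (L : ℝ)⁻¹) ^ k := by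
  refine (lev_mul_norm_coarsen_sub_le_of_localRate L M hα h hR hsize k y μ).trans ?_
  have hL0 : (0 : ℝ) ≤ (L : ℝ)⁻¹ := inv_nonneg.mpr (Nat.cast_nonneg L)
  have hθk : θ ^ k ≤ (max θ (L : ℝ)⁻¹) ^ k := pow_le_pow_left₀ hθ (le_max_left _ _) k
  have hLk : ((L : ℝ)⁻¹) ^ k ≤ (max θ (L : ℝ)⁻¹) ^ k := pow_le_pow_left₀ hL0 (le_max_right _ _) k
  have hA : 0 ≤ α ^ 2 / 2 * Real.exp α := by positivity
  nlinarith [mul_le_mul_of_nonneg_left hθk hC, mul_le_mul_of_nonneg_left hLk hA]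

/-- `L^k·(L⁻¹)^k = 1`. [folklore] -/
theorem lev_mul_inv_pow (k : ℕ) : ((L ^ k : ℕ) : ℝ) * ((L : ℝ)⁻¹) ^ k = 1 := by
  have hL : (L : ℝ) ≠ 0 := Nat.cast_ne_zero.mpr (NeZero.ne L)
  push_cast
  rw [← mul_pow, mul_inv_cancel₀ hL, one_pow]

/-- the same in the END's class currency `n²·m_k ≤ c_m` (`VariationalCovariantEnd`, owner): at `0 ≤ θ ≤ L⁻¹`,
`(L^k)²·‖coarsen (fineOf R k) (y,μ) − R k y μ‖ ≤ 2C + (α²∕2)e^α`, k-UNIFORM. [folklore] -/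
theorem sq_lev_mul_norm_coarsen_sub_le_of_localRate {𝒟 : Set ((k : ℕ) → Tor (fine (L ^ k) M) → Fin d → ℂ)} {C θ α : ℝ}
    (hC : 0 ≤ C) (hθ : 0 ≤ θ) (hθL : θ ≤ (L : ℝ)⁻¹) (hα : 0 ≤ α) (h : LocalRate (towReadings L M 𝒟) C θ)
    {R : (k : ℕ) → Tor (fine (L ^ k) M) → Fin d → ℂ} (hR : R ∈ 𝒟) (hsize : ∀ k x μ, ‖((L ^ k : ℕ) : ℂ) * (R k x μ - 1)‖ ≤ α)
    (k : ℕ) (y : Tor (fine (L ^ k) M)) (μ : Fin d) :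
    ((L ^ k : ℕ) : ℝ) ^ 2 * ‖coarsen L (fine (L ^ k) M) (fineOf L M R k) y μ - R k y μ‖ ≤ 2 * C + α ^ 2 / 2 * Real.exp α := by
  have h1 := lev_mul_norm_coarsen_sub_le_of_localRate_lev L M hC hθ hθL hα h hR hsize k y μ
  have hn : (0 : ℝ) ≤ ((L ^ k : ℕ) : ℝ) := Nat.cast_nonneg _
  calc ((L ^ k : ℕ) : ℝ) ^ 2 * ‖coarsen L (fine (L ^ k) M) (fineOf L M R k) y μ - R k y μ‖
      = ((L ^ k : ℕ) : ℝ) * (((L ^ k : ℕ) : ℝ) * ‖coarsen L (fine (L ^ k) M) (fineOf L M R k) y μ - R k y μ‖) := by ring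
    _ ≤ ((L ^ k : ℕ) : ℝ) * ((2 * C + α ^ 2 / 2 * Real.exp α) * ((L : ℝ)⁻¹) ^ k) := mul_le_mul_of_nonneg_left h1 hn
    _ = 2 * C + α ^ 2 / 2 * Real.exp α := by
        rw [mul_comm (2 * C + _), ← mul_assoc, lev_mul_inv_pow, one_mul]

/-! ## §6 Plug shapes: the spliced tower's mismatch, and leaf s8's `hρ` discharged from `LocalRate` -/

/-- **THE SPLICED TOWER's MISMATCH ⟸ NE3 PART + RUN B's OWN PART**: for the canonical pair with coarse datum `R k` and fine datum
`fineOf R k` (so `Rtr (fineOf R k) = R (k+1)`), one-step site transports `T′` with `‖T′‖ ≤ 1`: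
`L^k·‖mis (R k) (fineOf R k) T′ (y,μ,j)‖ ≤ (2Cθ^k + (α²∕2)e^α (L⁻¹)^k) + L^k·‖mis (coarsen (fineOf R k)) (fineOf R k) T′ (y,μ,j)‖` — the second
term is run B's own loop defect (the CLASS geometric leaf, not this file). [folklore] -/
theorem lev_mul_norm_mis_le_of_localRate {𝒟 : Set ((k : ℕ) → Tor (fine (L ^ k) M) → Fin d → ℂ)} {C θ α : ℝ}
    (hα : 0 ≤ α) (h : LocalRate (towReadings L M 𝒟) C θ) {R : (k : ℕ) → Tor (fine (L ^ k) M) → Fin d → ℂ} (hR : R ∈ 𝒟)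
    (hsize : ∀ k x μ, ‖((L ^ k : ℕ) : ℂ) * (R k x μ - 1)‖ ≤ α) (k : ℕ) {T' : Tor (fine L (fine (L ^ k) M)) → ℂ}
    (hT' : ∀ x, ‖T' x‖ ≤ 1) (y : Tor (fine (L ^ k) M)) (μ : Fin d) (j : Fin d → Fin L) :
    ((L ^ k : ℕ) : ℝ) * ‖mis L (fine (L ^ k) M) (R k) (fineOf L M R k) T' y μ j‖
      ≤ (2 * (C * θ ^ k) + α ^ 2 / 2 * Real.exp α * ((L : ℝ)⁻¹) ^ k)
        + ((L ^ k : ℕ) : ℝ) * ‖mis L (fine (L ^ k) M) (coarsen L (fine (L ^ k) M) (fineOf L M R k)) (fineOf L M R k) T' y μ j‖ := by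
  have h1 := norm_mis_le L (fine (L ^ k) M) (R k) (coarsen L (fine (L ^ k) M) (fineOf L M R k)) (fineOf L M R k) hT' y μ j
  have h2 := lev_mul_norm_coarsen_sub_le_of_localRate L M hα h hR hsize k y μ
  rw [norm_sub_rev] at h2
  calc ((L ^ k : ℕ) : ℝ) * ‖mis L (fine (L ^ k) M) (R k) (fineOf L M R k) T' y μ j‖
      ≤ ((L ^ k : ℕ) : ℝ) * (‖R k y μ - coarsen L (fine (L ^ k) M) (fineOf L M R k) y μ‖
          + ‖mis L (fine (L ^ k) M) (coarsen L (fine (L ^ k) M) (fineOf L M R k)) (fineOf L M R k) T' y μ j‖) :=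
        mul_le_mul_of_nonneg_left h1 (Nat.cast_nonneg _)
    _ ≤ _ := by rw [mul_add]; exact add_le_add h2 le_rfl

/-- **THE SPLICED TOWER's FACE-CROSSING DEFECT (`hcross` of the END) ⟸ RUN (k+1)'s OWN PART + NE3 PART**: for ANY dressed crossing phase
`X` (e.g. `R′(b_j) μ·conj(T′(b_j + e_μ))·T′(b_j)` at `j_μ + 1 = L`), `L^k·‖X − R k y μ‖ ≤ L^k·‖X − coarsen (fineOf R k) (y,μ)‖ + (2Cθ^k + (α²∕2)e^α(L⁻¹)^k)`
— the first term compares two objects of run `k+1` alone (geometry), the second is this file's NE3 part. [folklore] -/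
theorem lev_mul_norm_sub_coarse_le_of_localRate {𝒟 : Set ((k : ℕ) → Tor (fine (L ^ k) M) → Fin d → ℂ)} {C θ α : ℝ}
    (hα : 0 ≤ α) (h : LocalRate (towReadings L M 𝒟) C θ) {R : (k : ℕ) → Tor (fine (L ^ k) M) → Fin d → ℂ} (hR : R ∈ 𝒟)
    (hsize : ∀ k x μ, ‖((L ^ k : ℕ) : ℂ) * (R k x μ - 1)‖ ≤ α) (k : ℕ) (X : ℂ) (y : Tor (fine (L ^ k) M)) (μ : Fin d) :
    ((L ^ k : ℕ) : ℝ) * ‖X - R k y μ‖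
      ≤ ((L ^ k : ℕ) : ℝ) * ‖X - coarsen L (fine (L ^ k) M) (fineOf L M R k) y μ‖
        + (2 * (C * θ ^ k) + α ^ 2 / 2 * Real.exp α * ((L : ℝ)⁻¹) ^ k) := by
  have h1 : ‖X - R k y μ‖ ≤ ‖X - coarsen L (fine (L ^ k) M) (fineOf L M R k) y μ‖ + ‖coarsen L (fine (L ^ k) M) (fineOf L M R k) y μ - R k y μ‖ :=
    norm_sub_le_norm_sub_add_norm_sub _ _ _
  have h2 := lev_mul_norm_coarsen_sub_le_of_localRate L M hα h hR hsize k y μ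
  calc ((L ^ k : ℕ) : ℝ) * ‖X - R k y μ‖
      ≤ ((L ^ k : ℕ) : ℝ) * (‖X - coarsen L (fine (L ^ k) M) (fineOf L M R k) y μ‖
          + ‖coarsen L (fine (L ^ k) M) (fineOf L M R k) y μ - R k y μ‖) := mul_le_mul_of_nonneg_left h1 (Nat.cast_nonneg _)
    _ ≤ _ := by rw [mul_add]; exact add_le_add le_rfl h2

/-- the NE3 number handed to leaf s8: `ρ_k := (2Cθ^k + (α²∕2)e^α (L⁻¹)^k) ∕ L^k`. [folklore] -/
def rhoNE3 (C θ α : ℝ) (k : ℕ) : ℝ := (2 * (C * θ ^ k) + α ^ 2 / 2 * Real.exp α * ((L : ℝ)⁻¹) ^ k) / ((L ^ k : ℕ) : ℝ)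

/-- `L^k·ρ_k = 2Cθ^k + (α²∕2)e^α (L⁻¹)^k`. [folklore] -/
theorem lev_mul_rhoNE3 (C θ α : ℝ) (k : ℕ) :
    ((L ^ k : ℕ) : ℝ) * rhoNE3 L C θ α k = 2 * (C * θ ^ k) + α ^ 2 / 2 * Real.exp α * ((L : ℝ)⁻¹) ^ k := by
  have hn0 : ((L ^ k : ℕ) : ℝ) ≠ 0 := by
    push_cast; exact pow_ne_zero k (Nat.cast_ne_zero.mpr (NeZero.ne L))
  rw [rhoNE3, mul_div_cancel₀ _ hn0]

omit [NeZero L] in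
/-- `0 ≤ ρ_k` for `0 ≤ C`, `0 ≤ θ`. [folklore] -/
theorem rhoNE3_nonneg {C θ : ℝ} (hC : 0 ≤ C) (hθ : 0 ≤ θ) (α : ℝ) (k : ℕ) : 0 ≤ rhoNE3 L C θ α k := by
  unfold rhoNE3
  have : (0 : ℝ) ≤ ((L : ℝ)⁻¹) ^ k := pow_nonneg (inv_nonneg.mpr (Nat.cast_nonneg L)) k
  positivity

/-- in the END's class currency: at `0 ≤ θ ≤ L⁻¹`, `(L^k)²·ρ_k ≤ 2C + (α²∕2)e^α`, k-UNIFORM. [folklore] -/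
theorem sq_lev_mul_rhoNE3_le {C θ : ℝ} (hC : 0 ≤ C) (hθ : 0 ≤ θ) (hθL : θ ≤ (L : ℝ)⁻¹) (α : ℝ) (k : ℕ) :
    ((L ^ k : ℕ) : ℝ) ^ 2 * rhoNE3 L C θ α k ≤ 2 * C + α ^ 2 / 2 * Real.exp α := by
  have hn : (0 : ℝ) ≤ ((L ^ k : ℕ) : ℝ) := Nat.cast_nonneg _
  have hθk : θ ^ k ≤ ((L : ℝ)⁻¹) ^ k := pow_le_pow_left₀ hθ hθL k
  have e : ((L ^ k : ℕ) : ℝ) ^ 2 * rhoNE3 L C θ α k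
      = ((L ^ k : ℕ) : ℝ) * (2 * (C * θ ^ k) + α ^ 2 / 2 * Real.exp α * ((L : ℝ)⁻¹) ^ k) := by
    rw [sq, mul_assoc, lev_mul_rhoNE3]
  rw [e]
  calc ((L ^ k : ℕ) : ℝ) * (2 * (C * θ ^ k) + α ^ 2 / 2 * Real.exp α * ((L : ℝ)⁻¹) ^ k)
      ≤ ((L ^ k : ℕ) : ℝ) * (2 * (C * ((L : ℝ)⁻¹) ^ k) + α ^ 2 / 2 * Real.exp α * ((L : ℝ)⁻¹) ^ k) := by
        gcongr
    _ = (2 * C + α ^ 2 / 2 * Real.exp α) * (((L ^ k : ℕ) : ℝ) * ((L : ℝ)⁻¹) ^ k) := by ring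
    _ = 2 * C + α ^ 2 / 2 * Real.exp α := by rw [lev_mul_inv_pow, mul_one]

/-- **LEAF s8's `hρ` DISCHARGED FROM NODE U1b's `LocalRate`** (equal unit-modulus site transports `T` on both sides): the aligned-connection
distance between the straight-product coarsening of the next level and the coarse phases is `≤ ρ_k`, `L^k·ρ_k = 2Cθ^k + (α²∕2)e^α (L⁻¹)^k`.
[folklore] -/
theorem hrho_of_localRate {𝒟 : Set ((k : ℕ) → Tor (fine (L ^ k) M) → Fin d → ℂ)} {C θ α : ℝ}
    (hα : 0 ≤ α) (h : LocalRate (towReadings L M 𝒟) C θ) {R : (k : ℕ) → Tor (fine (L ^ k) M) → Fin d → ℂ} (hR : R ∈ 𝒟)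
    (hsize : ∀ k x μ, ‖((L ^ k : ℕ) : ℂ) * (R k x μ - 1)‖ ≤ α) (k : ℕ) {T : Tor (fine (L ^ k) M) → ℂ} (hT : ∀ x, ‖T x‖ = 1)
    (y : Tor (fine (L ^ k) M)) (μ : Fin d) :
    ‖aligned (fine (L ^ k) M) (phaseRatio (fine (L ^ k) M) T T) (coarsen L (fine (L ^ k) M) (fineOf L M R k)) y μ - R k y μ‖
      ≤ rhoNE3 L C θ α k := by
  have hn0 : (0 : ℝ) < ((L ^ k : ℕ) : ℝ) := by
    push_cast; exact pow_pos (Nat.cast_pos.mpr (Nat.pos_of_ne_zero (NeZero.ne L))) k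
  rw [aligned_phaseRatio_self _ hT, rhoNE3, le_div_iff₀ hn0, mul_comm]
  exact lev_mul_norm_coarsen_sub_le_of_localRate L M hα h hR hsize k y μ

/-- **THE TWO-RUNS FACE OF THE SCALAR COVARIANT BRACKET, ITS NE3 INPUT CONSUMED BY NAME** (leaf s8 `scalar_lipschitz_abs` with `hρ` from node U1b's
`LocalRate`): for a tower `R` of the class with the size bound `α`, equal unit-modulus site transports `T` at level `L^k`, leaves UB⁺ (`Λ`) and P⁺
(`C_P`) for both coarse data `(R k, T)` and `(coarsen (fineOf R k), T)`:
`|Δ′(Π_L R_{k+1}, T)(μ) − Δ′(R_k, T)(μ)| ≤ (2δ_k√(ΛC_P(Λ+1)) + δ_k²C_P(Λ+1))·nsq μ`, `δ_k = √d·(L^k·ρ_k)`, `L^k·ρ_k = 2Cθ^k + (α²∕2)e^α(L⁻¹)^k`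
(`lev_mul_rhoNE3`).  NE3 is NOT proved by this; `LocalRate` is displayed. [folklore] -/
theorem two_runs_lipschitz_of_localRate {𝒟 : Set ((k : ℕ) → Tor (fine (L ^ k) M) → Fin d → ℂ)} {C θ α : ℝ}
    (hC : 0 ≤ C) (hθ : 0 ≤ θ) (hα : 0 ≤ α) (h : LocalRate (towReadings L M 𝒟) C θ)
    {R : (k : ℕ) → Tor (fine (L ^ k) M) → Fin d → ℂ} (hR : R ∈ 𝒟) (hsize : ∀ k x μ, ‖((L ^ k : ℕ) : ℂ) * (R k x μ - 1)‖ ≤ α)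
    (k : ℕ) {T : Tor (fine (L ^ k) M) → ℂ} (hT : ∀ x, ‖T x‖ = 1) {Λ CP : ℝ} (hΛ : 0 ≤ Λ) (hCP : 0 ≤ CP)
    (hUB : ∀ μ : Tor M → ℂ, ∃ f, Qk (L ^ k) M T f = μ ∧ Sc (L ^ k) M (R k) f ≤ Λ * nsq μ)
    (hP : ∀ f, qW (L ^ k) M f ≤ CP * (Sc (L ^ k) M (R k) f + nsq (Qk (L ^ k) M T f)))
    (hUB' : ∀ μ : Tor M → ℂ, ∃ f, Qk (L ^ k) M T f = μ ∧ Sc (L ^ k) M (coarsen L (fine (L ^ k) M) (fineOf L M R k)) f ≤ Λ * nsq μ)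
    (hP' : ∀ f, qW (L ^ k) M f ≤ CP * (Sc (L ^ k) M (coarsen L (fine (L ^ k) M) (fineOf L M R k)) f + nsq (Qk (L ^ k) M T f)))
    (μ : Tor M → ℂ) :
    |blockSpin (Qk (L ^ k) M T) (Sc (L ^ k) M (coarsen L (fine (L ^ k) M) (fineOf L M R k))) μ
        - blockSpin (Qk (L ^ k) M T) (Sc (L ^ k) M (R k)) μ|
      ≤ (2 * (Real.sqrt d * (((L ^ k : ℕ) : ℝ) * rhoNE3 L C θ α k)) * Real.sqrt (Λ * (CP * (Λ + 1)))
          + (Real.sqrt d * (((L ^ k : ℕ) : ℝ) * rhoNE3 L C θ α k)) ^ 2 * (CP * (Λ + 1))) * nsq μ :=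
  scalar_lipschitz_abs (L ^ k) M hT hT (rhoNE3_nonneg L hC hθ α k) (hrho_of_localRate L M hα h hR hsize k hT) hΛ hCP hUB hP hUB' hP' μ

end Summit.QuantumFields.BalabanUV.T4Continuum.VariationalCovariantTwoRunsNE3

end
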